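import Mathlib

/-!
# LEMMA (INV-STAR) of ROW C-041 — (INV) on the star gadget, by the cube-complement injection (p6, gen 25)

mine-3's LEMMA (INV-STAR) (proofs/C-041.md §10 (f)): for the star gadget — a red-connected `(K₀, O)` containing the
probe `c` and a vertex `k ≠ c`, no terminal edges and no blue edges inside `K₀`, plus a simple blue star
`Z = {k, v₁, …, v_m}` whose leaf `v_i` carries `k_t(v_i)` edges to the terminal `t` and `k_j(v_i)` edges to the other
terminal `j` and no other edge; `u″ = k`; `12 ∈ E` — the invalid-states inequality (INV) holds:
`#{states : ¬G_t ∧ ρ_t} ≥ #{invalid states}`.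

THE ABSTRACT STAR MODEL (the paper's description of the states, §10 (f) PROOF): a state is `(A, τ)` — `A` the set of
OPEN leaves (edge `k v_i` red in the layer `X`), `τ` a colouring of the terminal edges at the leaves; the sub-zones are
`C₀ = {k} ∪ {v_i : i ∉ A}` and the singletons `{v_i}`, `i ∈ A`; `K(X) = K₀ ∪ {v_i : i ∈ A}`.  Read off:
* ADMISSIBLE: no sub-zone with a blue `t`-edge and a blue `j`-edge (`AdmS`);
* INVALID: every terminal edge at an open leaf is blue (`InvalidS`: no red terminal edge lands in `K(X)`);
* `ρ_t`: `k ∉ D_t`, i.e. every `t`-edge at a closed leaf is red (`RhoS`);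
* `G_t`: `ρ_t` and some open leaf with all its `t`-edges red (hence in `R_t`) carries a red `j`-edge (`GoodS`; with
  `¬ρ_t` the leaves are cut off from `c` and `K₀` has no endpoints).

THE THEOREM `invalidCountS_le_mCountS`: `#{adm ∧ invalid} ≤ #{adm ∧ ¬G_t ∧ ρ_t}`, by the paper's CUBE-COMPLEMENT
map `psi` on the states `invalid ∧ ¬ρ_t` (`(A, τ) ↦ (Ā, τ′)`: an open leaf closes with its `t`-edges turned red and
its `j`-edges blue; a closed leaf opens with its `t`-edges complemented and its `j`-edges turned blue exactly when all
its `t`-edges were blue) — an injection into the valid states with `¬G_t ∧ ρ_t` (`psi_injOn`, `psi_mem`) — together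
with `invalid ∧ ρ_t ⊆ ¬G_t ∧ ρ_t`.  Both sides at once: `invalidCountS_le_mCountS'` (the model is symmetric under
`kt ↔ ko`).  NOT claimed: the identification of these states with the cube states `IsCubeState` of a skeleton (the
paper's reading of the star; the reduction is not typed), nor the closed forms `L`, `R` of §10 (f).
-/

namespace PercRepro

namespace InvStar

open Finset

variable {ι : Type*} [Fintype ι] [DecidableEq ι]

/-- A state of the star model: the open leaves, the `t`-edges and the `j`-edges at every leaf (`true` = red). -/
abbrev StarState (ι : Type*) (kt ko : ι → ℕ) : Type _ :=
  Finset ι × ((i : ι) → Fin (kt i) → Bool) × ((i : ι) → Fin (ko i) → Bool)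

variable {kt ko : ι → ℕ}

/-- Admissible: no open leaf and not the sub-zone of `k` (the closed leaves) carries a blue `t`-edge together with a
blue `j`-edge. -/
def AdmS (s : StarState ι kt ko) : Prop :=
  (∀ i ∈ s.1, ¬ ((∃ e, s.2.1 i e = false) ∧ (∃ e, s.2.2 i e = false))) ∧
    ¬ ((∃ i, i ∉ s.1 ∧ ∃ e, s.2.1 i e = false) ∧ (∃ i, i ∉ s.1 ∧ ∃ e, s.2.2 i e = false))

/-- Invalid: every terminal edge at an open leaf is blue. -/
def InvalidS (s : StarState ι kt ko) : Prop :=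
  ∀ i ∈ s.1, (∀ e, s.2.1 i e = false) ∧ (∀ e, s.2.2 i e = false)

/-- `ρ_t`: every `t`-edge at a closed leaf is red (`k ∉ D_t`). -/
def RhoS (s : StarState ι kt ko) : Prop := ∀ i, i ∉ s.1 → ∀ e, s.2.1 i e = true

/-- `G_t`: `ρ_t` holds and some open leaf with all its `t`-edges red carries a red `j`-edge. -/
def GoodS (s : StarState ι kt ko) : Prop :=
  RhoS s ∧ ∃ i ∈ s.1, (∀ e, s.2.1 i e = true) ∧ ∃ e, s.2.2 i e = true

open Classical in
/-- `I`: the number of admissible invalid states. -/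
noncomputable def invalidCountS (kt ko : ι → ℕ) : ℕ :=
  (univ.filter fun s : StarState ι kt ko => AdmS s ∧ InvalidS s).card

open Classical in
/-- `m_t(k)`: the number of admissible states with `¬G_t ∧ ρ_t`. -/
noncomputable def mCountS (kt ko : ι → ℕ) : ℕ :=
  (univ.filter fun s : StarState ι kt ko => AdmS s ∧ ¬ GoodS s ∧ RhoS s).card

open Classical in
/-- **The cube-complement map** of C-041.md §10 (f): `(A, τ) ↦ (Ā, τ′)` — an open leaf closes, its `t`-edges turn
red and its `j`-edges blue; a closed leaf opens, its `t`-edges are complemented and its `j`-edges turn blue exactly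
when all its `t`-edges were blue (otherwise they stay red). -/
noncomputable def psi (s : StarState ι kt ko) : StarState ι kt ko :=
  (s.1ᶜ, fun i e => if i ∈ s.1 then true else !(s.2.1 i e),
    fun i _ => if i ∈ s.1 then false else if (∀ e', s.2.1 i e' = false) then false else true)

omit [Fintype ι] [DecidableEq ι] in
/-- An invalid state is not Good. -/
theorem not_goodS_of_invalidS {s : StarState ι kt ko} (h : InvalidS s) : ¬ GoodS s := by
  rintro ⟨_, i, hi, _, e, he⟩
  rw [(h i hi).2 e] at he
  exact Bool.noConfusion he

omit [Fintype ι] [DecidableEq ι] in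
/-- `¬ρ_t` gives a closed leaf with a blue `t`-edge. -/
theorem exists_blue_of_not_rhoS {s : StarState ι kt ko} (hρ : ¬ RhoS s) :
    ∃ i, i ∉ s.1 ∧ ∃ e, s.2.1 i e = false := by
  by_contra h
  apply hρ
  intro i hi e
  cases hx : s.2.1 i e
  · exact absurd ⟨i, hi, e, hx⟩ h
  · rfl

omit [Fintype ι] [DecidableEq ι] in
/-- In an admissible state with `¬ρ_t`, every `j`-edge at a closed leaf is red. -/
theorem closed_o_red {s : StarState ι kt ko} (hadm : AdmS s) (hρ : ¬ RhoS s) :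
    ∀ i, i ∉ s.1 → ∀ e, s.2.2 i e = true := by
  intro i hi e
  by_contra he
  have he' : s.2.2 i e = false := by
    cases h : s.2.2 i e
    · rfl
    · exact absurd h he
  exact hadm.2 ⟨exists_blue_of_not_rhoS hρ, i, hi, e, he'⟩

/-- The open-leaf set of the image is the complement. -/
theorem psi_fst (s : StarState ι kt ko) : (psi s).1 = s.1ᶜ := rfl

/-- The `t`-edges of the image at a closed leaf of the source are complemented. -/
theorem psi_t_of_not_mem (s : StarState ι kt ko) {i : ι} (hi : i ∉ s.1) (e : Fin (kt i)) :
    (psi s).2.1 i e = !(s.2.1 i e) := by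
  unfold psi
  simp [hi]

/-- The `t`-edges of the image at an open leaf of the source are red. -/
theorem psi_t_of_mem (s : StarState ι kt ko) {i : ι} (hi : i ∈ s.1) (e : Fin (kt i)) :
    (psi s).2.1 i e = true := by
  unfold psi
  simp [hi]

/-- The `j`-edges of the image at an open leaf of the source are blue. -/
theorem psi_o_of_mem (s : StarState ι kt ko) {i : ι} (hi : i ∈ s.1) (e : Fin (ko i)) :
    (psi s).2.2 i e = false := by
  unfold psi
  simp [hi]

open Classical in
/-- The `j`-edges of the image at a closed leaf of the source are blue iff all its `t`-edges were blue. -/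
theorem psi_o_of_not_mem (s : StarState ι kt ko) {i : ι} (hi : i ∉ s.1) (e : Fin (ko i)) :
    (psi s).2.2 i e = (if (∀ e', s.2.1 i e' = false) then false else true) := by
  unfold psi
  simp [hi]

/-- **The image lies in the target**: for a state with `¬ρ_t` (admissibility and invalidity are not even needed
here), the image is admissible, not Good, has `ρ_t`, and is valid. -/
theorem psi_mem {s : StarState ι kt ko} (hρ : ¬ RhoS s) :
    AdmS (psi s) ∧ ¬ GoodS (psi s) ∧ RhoS (psi s) ∧ ¬ InvalidS (psi s) := by
  have hρ' := exists_blue_of_not_rhoS hρ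
  refine ⟨⟨?_, ?_⟩, ?_, ?_, ?_⟩
  · -- open leaves of the image = closed leaves of the source
    intro i hi
    rw [psi_fst, Finset.mem_compl] at hi
    rintro ⟨⟨e, he⟩, ⟨f, hf⟩⟩
    rw [psi_t_of_not_mem s hi] at he
    rw [psi_o_of_not_mem s hi] at hf
    have hall : ¬ (∀ e', s.2.1 i e' = false) := fun h => by
      rw [h e] at he
      exact Bool.noConfusion he
    rw [if_neg hall] at hf
    exact Bool.noConfusion hf
  · -- the closed leaves of the image carry red `t`-edges
    rintro ⟨⟨i, hi, e, he⟩, _⟩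
    rw [psi_fst, Finset.mem_compl, not_not] at hi
    rw [psi_t_of_mem s hi] at he
    exact Bool.noConfusion he
  · -- not Good
    rintro ⟨_, i, hi, hall, e, he⟩
    rw [psi_fst, Finset.mem_compl] at hi
    rw [psi_o_of_not_mem s hi] at he
    have hblue : ∀ e', s.2.1 i e' = false := by
      intro e'
      have := hall e'
      rw [psi_t_of_not_mem s hi] at this
      simpa using this
    rw [if_pos hblue] at he
    exact Bool.noConfusion he
  · -- `ρ_t`
    intro i hi e
    rw [psi_fst, Finset.mem_compl, not_not] at hi
    exact psi_t_of_mem s hi e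
  · -- valid
    intro hinv'
    obtain ⟨i, hi, e, he⟩ := hρ'
    have hi' : i ∈ (psi s).1 := by
      rw [psi_fst, Finset.mem_compl]
      exact hi
    have := (hinv' i hi').1 e
    rw [psi_t_of_not_mem s hi, he] at this
    exact Bool.noConfusion this

/-- **Injectivity** of the cube-complement map on the admissible invalid states with `¬ρ_t`. -/
theorem psi_injOn {s s' : StarState ι kt ko} (hadm : AdmS s) (hinv : InvalidS s) (hρ : ¬ RhoS s)
    (hadm' : AdmS s') (hinv' : InvalidS s') (hρ' : ¬ RhoS s') (h : psi s = psi s') : s = s' := by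
  have hA : s.1 = s'.1 := by
    have := congrArg Prod.fst h
    rw [psi_fst, psi_fst] at this
    exact compl_inj_iff.1 this
  have ht : s.2.1 = s'.2.1 := by
    funext i e
    by_cases hi : i ∈ s.1
    · rw [(hinv i hi).1 e, (hinv' i (hA ▸ hi)).1 e]
    · have := congrFun (congrFun (congrArg (fun p => p.2.1) h) i) e
      rw [psi_t_of_not_mem s hi, psi_t_of_not_mem s' (hA ▸ hi)] at this
      simpa using this
  have ho : s.2.2 = s'.2.2 := by
    funext i e
    by_cases hi : i ∈ s.1
    · rw [(hinv i hi).2 e, (hinv' i (hA ▸ hi)).2 e]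
    · rw [closed_o_red hadm hρ i hi e, closed_o_red hadm' hρ' i (hA ▸ hi) e]
  exact Prod.ext hA (Prod.ext ht ho)

open Classical in
/-- **LEMMA (INV-STAR)** (C-041.md §10 (f)): on the star gadget, `#{invalid states} ≤ #{states : ¬G_t ∧ ρ_t}`. -/
theorem invalidCountS_le_mCountS (kt ko : ι → ℕ) : invalidCountS kt ko ≤ mCountS kt ko := by
  unfold invalidCountS mCountS
  set L₀ := univ.filter fun s : StarState ι kt ko => (AdmS s ∧ InvalidS s) ∧ RhoS s with hL₀
  set L₁ := univ.filter fun s : StarState ι kt ko => (AdmS s ∧ InvalidS s) ∧ ¬ RhoS s with hL₁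
  set T := univ.filter fun s : StarState ι kt ko => AdmS s ∧ ¬ GoodS s ∧ RhoS s with hT
  have hsplit : (univ.filter fun s : StarState ι kt ko => AdmS s ∧ InvalidS s) = L₀ ∪ L₁ := by
    rw [hL₀, hL₁, ← Finset.filter_or]
    apply Finset.filter_congr
    intro s _
    tauto
  have hdisj : Disjoint L₀ L₁ := by
    rw [Finset.disjoint_left]
    intro s hs hs'
    rw [hL₀, Finset.mem_filter] at hs
    rw [hL₁, Finset.mem_filter] at hs'
    exact hs'.2.2 hs.2.2
  have hL₀T : L₀ ⊆ T := by
    intro s hs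
    rw [hL₀, Finset.mem_filter] at hs
    rw [hT, Finset.mem_filter]
    exact ⟨Finset.mem_univ _, hs.2.1.1, not_goodS_of_invalidS hs.2.1.2, hs.2.2⟩
  have hL₁T : L₁.image psi ⊆ T := by
    intro s' hs'
    rw [Finset.mem_image] at hs'
    obtain ⟨s, hs, rfl⟩ := hs'
    rw [hL₁, Finset.mem_filter] at hs
    obtain ⟨h1, h2, h3, _⟩ := psi_mem hs.2.2
    rw [hT, Finset.mem_filter]
    exact ⟨Finset.mem_univ _, h1, h2, h3⟩
  have hdisj' : Disjoint L₀ (L₁.image psi) := by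
    rw [Finset.disjoint_left]
    intro s hs hs'
    rw [Finset.mem_image] at hs'
    obtain ⟨s₀, hs₀, rfl⟩ := hs'
    rw [hL₁, Finset.mem_filter] at hs₀
    rw [hL₀, Finset.mem_filter] at hs
    exact (psi_mem hs₀.2.2).2.2.2 hs.2.1.2
  have hinj : Set.InjOn psi (L₁ : Set (StarState ι kt ko)) := by
    intro s hs s' hs' h
    rw [Finset.mem_coe, hL₁, Finset.mem_filter] at hs hs'
    exact psi_injOn hs.2.1.1 hs.2.1.2 hs.2.2 hs'.2.1.1 hs'.2.1.2 hs'.2.2 h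
  calc (univ.filter fun s : StarState ι kt ko => AdmS s ∧ InvalidS s).card
      = L₀.card + L₁.card := by rw [hsplit, Finset.card_union_of_disjoint hdisj]
    _ = L₀.card + (L₁.image psi).card := by rw [Finset.card_image_of_injOn hinj]
    _ = (L₀ ∪ L₁.image psi).card := (Finset.card_union_of_disjoint hdisj').symm
    _ ≤ T.card := Finset.card_le_card (Finset.union_subset hL₀T hL₁T)

/-- The swap of the two terminals: the state spaces of `(kt, ko)` and `(ko, kt)` are in bijection. -/
def swapState (kt ko : ι → ℕ) : StarState ι kt ko ≃ StarState ι ko kt where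
  toFun s := (s.1, s.2.2, s.2.1)
  invFun s := (s.1, s.2.2, s.2.1)
  left_inv _ := rfl
  right_inv _ := rfl

omit [Fintype ι] [DecidableEq ι] in
/-- The inverse of the swap is the swap. -/
theorem swapState_symm (kt ko : ι → ℕ) (s : StarState ι ko kt) :
    (swapState kt ko).symm s = swapState ko kt s := rfl

omit [Fintype ι] [DecidableEq ι] in
/-- The swap is an involution. -/
theorem swapState_swapState (kt ko : ι → ℕ) (s : StarState ι ko kt) :
    swapState kt ko (swapState ko kt s) = s := rfl

omit [Fintype ι] [DecidableEq ι] in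
/-- Admissibility is symmetric under the swap. -/
theorem admS_swap (s : StarState ι kt ko) : AdmS (swapState kt ko s) ↔ AdmS s := by
  unfold AdmS swapState
  simp only [Equiv.coe_fn_mk]
  constructor
  · rintro ⟨h1, h2⟩
    exact ⟨fun i hi h => h1 i hi ⟨h.2, h.1⟩, fun h => h2 ⟨h.2, h.1⟩⟩
  · rintro ⟨h1, h2⟩
    exact ⟨fun i hi h => h1 i hi ⟨h.2, h.1⟩, fun h => h2 ⟨h.2, h.1⟩⟩

omit [Fintype ι] [DecidableEq ι] in
/-- Invalidity is symmetric under the swap. -/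
theorem invalidS_swap (s : StarState ι kt ko) : InvalidS (swapState kt ko s) ↔ InvalidS s := by
  unfold InvalidS swapState
  simp only [Equiv.coe_fn_mk]
  constructor
  · intro h i hi
    exact ⟨(h i hi).2, (h i hi).1⟩
  · intro h i hi
    exact ⟨(h i hi).2, (h i hi).1⟩

open Classical in
/-- The invalid count is symmetric under the swap of the terminals. -/
theorem invalidCountS_swap (kt ko : ι → ℕ) : invalidCountS ko kt = invalidCountS kt ko := by
  unfold invalidCountS
  rw [← Finset.card_map (swapState kt ko).toEmbedding]
  congr 1
  ext s
  rw [Finset.mem_map_equiv, Finset.mem_filter, Finset.mem_filter, swapState_symm, admS_swap, invalidS_swap]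
  simp only [Finset.mem_univ, true_and]

open Classical in
/-- `m_t` for the OTHER side, in the model of `(kt, ko)`: the states with `¬G_j ∧ ρ_j`, read through the swap. -/
noncomputable def mCountS' (kt ko : ι → ℕ) : ℕ :=
  (univ.filter fun s : StarState ι kt ko =>
    AdmS s ∧ ¬ GoodS (swapState kt ko s) ∧ RhoS (swapState kt ko s)).card

open Classical in
/-- **LEMMA (INV-STAR), both sides** (C-041.md §10 (f)): `I ≤ m_t` and `I ≤ m_j` on the star gadget. -/
theorem invalidCountS_le_mCountS' (kt ko : ι → ℕ) :
    invalidCountS kt ko ≤ mCountS kt ko ∧ invalidCountS kt ko ≤ mCountS' kt ko := by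
  refine ⟨invalidCountS_le_mCountS kt ko, ?_⟩
  rw [← invalidCountS_swap]
  refine (invalidCountS_le_mCountS ko kt).trans (le_of_eq ?_)
  unfold mCountS mCountS'
  rw [← Finset.card_map (swapState kt ko).toEmbedding]
  congr 1
  ext s
  rw [Finset.mem_map_equiv, Finset.mem_filter, Finset.mem_filter, swapState_symm, admS_swap,
    swapState_swapState]
  simp only [Finset.mem_univ, true_and]

end InvStar

end PercRepro
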